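import Summits.Ventures.CertifiedManyBodySolver.Observables.PhaseSeparationExclusionTPrimeStripHighUThermal
import Summits.Ventures.CertifiedManyBodySolver.Observables.PhaseSeparationExclusionTPrimeStripHighUD
import Summits.Ventures.CertifiedManyBodySolver.Observables.PhaseSeparationExclusionTPrimeStripThermalFreeDilute
import Summits.Ventures.CertifiedManyBodySolver.Certificates.HubbardTTPrime_freeGC_kernelQuadrature_b8_tpm3o20_dilute
import Summits.Ventures.CertifiedManyBodySolver.Certificates.HubbardTTPrime_freeGC_kernelQuadrature_b8_tpm1o4_dilute
import HarnessLib

/-!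
# Ventures/CertifiedManyBodySolver — Observables/PhaseSeparationExclusionTPrimeStripHighUThermalFreeDilute.lean: hubbard-box-p3 g27's LARGE-`U`
# strip competing-order words at `T > 0`, RE-PRICED with the FREE-GAS DILUTE ANCHOR — `(≤ 1/5 | ≥ 1)` on `[−3/20, 0] × [8, 12]` every `β ≥ 17`
# (g24: `20`), on `[−3/20, 0] × [8, 10]` every `β ≥ 11` (`13`), on `[−1/5, 0] × [8, 10]` every `β ≥ 12` (`14`), on `[−1/4, 0] × [8, 9]` every `β ≥ 15`
# (`18`); `(≤ 1/4 | ≥ 1)` on `[−3/20, 0] × [8, 10]` every `β ≥ 18` (`22`), on `[−1/5, 0] × [8, 10]` every `β ≥ 20` (`24`), NEW on `[−1/4, 0] × [8, 9]`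
# every `β ≥ 19`; `(≤ 3/10 | ≥ 1)` on `[−1/10, 0] × [8, 9]` every `β ≥ 21` (`27`)

HONEST FRAMING: first certified bounds; not a superconductivity verdict. CLASS = DERIVED / CONTEXT: the free-dilute edition of this seat's g24 file
`Observables/PhaseSeparationExclusionTPrimeStripHighUThermal.lean` (the `T > 0` large-`U` cells of hubbard-box-p3 g27's `…TPrimeStripHighU{,B,D}.lean`):
the SAME cap plane (`lsco78_capPlane_on_cell_of`), the SAME `n = 1` column laws (`lsco_n1_law8_of` at `U = 8`; box-p3's TRIANGLE laws
`tri_n1_law{12h,10f,10m,12t,9f}_of` and their `U`-chords `hU_n1_law{10_of_12h,9_of_10f,9_of_12t}`), the SAME dilute floors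
(`strip_dilute{1o5,1o4,3o10}_floor`, `highU_dilute{1o5,1o4}_floor_q`), the SAME `n₂`-anchors (cuprate-point staircase nodes
`cert_feC1tt_stair221_tpm1o4_b{1,3o2}_j300793` read at `n = 1` on the band `|t′| ≤ 1/4 × U ≥ 8`) — and the DILUTE partner now anchored at `β_h = 8` by
the FREE `t–t′` GAS: `p(8; 1, s, U; n₁) ≤ P₀(8, s, μ) − 8μn₁` ∀`U ≥ 0` (`Literature/…/HubbardTTPrimeFreeGCPressure.lean`), `P₀` certified in the KERNEL
(`Certificates/HubbardTTPrime_freeGC_kernelQuadrature_b8_{tpm3o20,tpm1o5,tpm1o4,tp0}_dilute.lean`, no claim node), chorded in `t′` over `[s₁, 0]`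
(`Observables/PhaseSeparationExclusionBoxThermalFreeDilute.lean`; column form `psT_not_thermal_mix_on_cell_of_columns_hotAnchorSS`). CONTROL class
(partner phase dilute, hole doping `≥ 70 %`); conditional BY NAME on box-p3's claim nodes (VARBOX plane, K2DIAG-A `U = 8` node, #472 · #428 · #489 · #502)
+ one producer-certified C1 node per theorem; canonical sector-Gibbs torus limits; nothing about stripes / which phase is realised / SC / `T_c`; no number
of record. Zero kit, no `sorry`.

Cell `pub/hubbard-downfold` (MO-S1 ↔ S2 seam; D-0096 (ii)/(iii)), seat `hubbard-downfold-unc-2` (g25). THRESHOLDS (exact scan `gen-g25/scan_W4.py`; dilute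
bracket `Q₁(s) + 8 F₁(s) ≈ 0.03–0.07`; `T` readings on `t ∈ [0.34, 0.40]` eV [float]): `(1/5∣1)` A `[−3/20, 0] × [8, 12]` 16.45 (`β_h = 1`) ⇒ `β ≥ 17`
(`T ≲ 232–273 K`; g24 `20`); A′ `× [8, 10]` 10.72 (`β_h = 3/2`) ⇒ `β ≥ 11`; B `[−1/5, 0] × [8, 10]` 11.32 ⇒ `β ≥ 12`; C′ `[−1/4, 0] × [8, 9]` 14.53 ⇒
`β ≥ 15`; `(1/4∣1)` A′ 17.82 ⇒ `β ≥ 18`; B 19.13 ⇒ `β ≥ 20`; C′ (law `9f`) 18.76 ⇒ `β ≥ 19` (g24: untyped, `23.3`); `(3/10∣1)` A′ `[−1/10, 0] × [8, 9]`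
20.36 ⇒ `β ≥ 21` (dilute anchor chorded over `[−3/20, 0]`). Routed boxes with `t′/t ∈ [−0.25, 0]`, `U/t ≤ 12` (LSCO-OD / LBCO `t′ ≥ −1/5` parts up to
`U/t = 10`) carry the improved `T`-axis word. Generator `gen-g25/gen_W4.py` (asserts every typed inequality in exact rationals).
WHAT THIS IS NOT: a certificate; a CERTIFIED row; a word at `t′ < s₁`, `t′ > 0`, other `U`, or about SC; the `n₂`-anchors are PRODUCER-CERTIFIED claim nodes.
References: [Israel1979] Thm I.2.4 / I.3.4; [PoulinHastings2011]; [Ruelle1969] §3.3–3.4; [Griffiths1966]; [EmeryKivelsonLin1990].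
-/

noncomputable section

namespace Summit.Ventures.CertifiedManyBodySolver.Observables

open Summit.Ventures.CertifiedManyBodySolver.Certificates Summit.Ventures.CertifiedManyBodySolver.Downfold
open Literature.MathematicalPhysics.QuantumLattice Literature.MathematicalPhysics.QuantumLattice.ThermodynamicLimit InfVolFermionState Set Filter

/-! ## §0 Free-gas dilute anchors on `[−3/20, 0]` and `[−1/4, 0]` (those on `[−1/5, 0]` are `strip_freeDiluteCap_*`) -/

/-- **FREE-GAS DILUTE ANCHOR at `n₁ = 1/5` on `t′ ∈ [-3/20, 0]`** (`β_h = 8`, every `U ≥ 0`): `t′`-chord of the kernel ceilings `P₀(8, -3/20, -321/125) ≤ 70413/100000`,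
`P₀(8, 0, -711/250) ≤ 29291/31250` Legendre-shifted to density `1/5` (`4.8129300` @ `-3/20`, `5.4877120` @ `0`). [cite: Ruelle1969, §3.4] [cite: Israel1979, Thm. I.3.4] -/
theorem highU_freeDiluteCap_1o5_m3o20 {s₁ s₂ U₁ U₂ : ℝ} (hs₁ : -3 / 20 ≤ s₁) (hs₂ : s₂ ≤ 0) (hU₁ : 0 ≤ U₁) :
    ∀ s ∈ Icc s₁ s₂, ∀ U ∈ Icc U₁ U₂, pressureTT' (8 : ℝ) 1 s U (1 / 5 : ℝ) ≤
      ((0 - s) * ((70413 / 100000 : ℝ) - 8 * (-321 / 125) * (1 / 5)) + (s - (-3 / 20)) * ((29291 / 31250 : ℝ) - 8 * (-711 / 250) * (1 / 5))) /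
        (0 - (-3 / 20)) := by
  have hA := freeGCPressureTT'_b8_tpm3o20_n1o5_le
  have hB := freeGCPressureTT'_b8_tp0_n1o5_le
  push_cast at hA hB
  exact pressureTT'_le_schord_of_freeGCPressureTT' (βh := 8) (by norm_num) (n := 1 / 5) (by norm_num) (by norm_num)
    (sa := -3 / 20) (sb := 0) (by norm_num) hA hB hs₁ hs₂ hU₁

/-- **FREE-GAS DILUTE ANCHOR at `n₁ = 1/4` on `t′ ∈ [-3/20, 0]`** (`β_h = 8`, every `U ≥ 0`): `t′`-chord of the kernel ceilings `P₀(8, -3/20, -2373/1000) ≤ 1055137/1000000`,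
`P₀(8, 0, -2583/1000) ≤ 703461/500000` Legendre-shifted to density `1/4` (`5.8011370` @ `-3/20`, `6.5729220` @ `0`). [cite: Ruelle1969, §3.4] [cite: Israel1979, Thm. I.3.4] -/
theorem highU_freeDiluteCap_1o4_m3o20 {s₁ s₂ U₁ U₂ : ℝ} (hs₁ : -3 / 20 ≤ s₁) (hs₂ : s₂ ≤ 0) (hU₁ : 0 ≤ U₁) :
    ∀ s ∈ Icc s₁ s₂, ∀ U ∈ Icc U₁ U₂, pressureTT' (8 : ℝ) 1 s U (1 / 4 : ℝ) ≤
      ((0 - s) * ((1055137 / 1000000 : ℝ) - 8 * (-2373 / 1000) * (1 / 4)) + (s - (-3 / 20)) * ((703461 / 500000 : ℝ) - 8 * (-2583 / 1000) * (1 / 4))) /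
        (0 - (-3 / 20)) := by
  have hA := freeGCPressureTT'_b8_tpm3o20_n1o4_le
  have hB := freeGCPressureTT'_b8_tp0_n1o4_le
  push_cast at hA hB
  exact pressureTT'_le_schord_of_freeGCPressureTT' (βh := 8) (by norm_num) (n := 1 / 4) (by norm_num) (by norm_num)
    (sa := -3 / 20) (sb := 0) (by norm_num) hA hB hs₁ hs₂ hU₁

/-- **FREE-GAS DILUTE ANCHOR at `n₁ = 3/10` on `t′ ∈ [-3/20, 0]`** (`β_h = 8`, every `U ≥ 0`): `t′`-chord of the kernel ceilings `P₀(8, -3/20, -1093/500) ≤ 45829/31250`,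
`P₀(8, 0, -1167/500) ≤ 1954441/1000000` Legendre-shifted to density `3/10` (`6.7129280` @ `-3/20`, `7.5560410` @ `0`). [cite: Ruelle1969, §3.4] [cite: Israel1979, Thm. I.3.4] -/
theorem highU_freeDiluteCap_3o10_m3o20 {s₁ s₂ U₁ U₂ : ℝ} (hs₁ : -3 / 20 ≤ s₁) (hs₂ : s₂ ≤ 0) (hU₁ : 0 ≤ U₁) :
    ∀ s ∈ Icc s₁ s₂, ∀ U ∈ Icc U₁ U₂, pressureTT' (8 : ℝ) 1 s U (3 / 10 : ℝ) ≤
      ((0 - s) * ((45829 / 31250 : ℝ) - 8 * (-1093 / 500) * (3 / 10)) + (s - (-3 / 20)) * ((1954441 / 1000000 : ℝ) - 8 * (-1167 / 500) * (3 / 10))) /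
        (0 - (-3 / 20)) := by
  have hA := freeGCPressureTT'_b8_tpm3o20_n3o10_le
  have hB := freeGCPressureTT'_b8_tp0_n3o10_le
  push_cast at hA hB
  exact pressureTT'_le_schord_of_freeGCPressureTT' (βh := 8) (by norm_num) (n := 3 / 10) (by norm_num) (by norm_num)
    (sa := -3 / 20) (sb := 0) (by norm_num) hA hB hs₁ hs₂ hU₁

/-- **FREE-GAS DILUTE ANCHOR at `n₁ = 1/5` on `t′ ∈ [-1/4, 0]`** (`β_h = 8`, every `U ≥ 0`): `t′`-chord of the kernel ceilings `P₀(8, -1/4, -477/200) ≤ 277441/500000`,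
`P₀(8, 0, -711/250) ≤ 29291/31250` Legendre-shifted to density `1/5` (`4.3708820` @ `-1/4`, `5.4877120` @ `0`). [cite: Ruelle1969, §3.4] [cite: Israel1979, Thm. I.3.4] -/
theorem highU_freeDiluteCap_1o5_m1o4 {s₁ s₂ U₁ U₂ : ℝ} (hs₁ : -1 / 4 ≤ s₁) (hs₂ : s₂ ≤ 0) (hU₁ : 0 ≤ U₁) :
    ∀ s ∈ Icc s₁ s₂, ∀ U ∈ Icc U₁ U₂, pressureTT' (8 : ℝ) 1 s U (1 / 5 : ℝ) ≤
      ((0 - s) * ((277441 / 500000 : ℝ) - 8 * (-477 / 200) * (1 / 5)) + (s - (-1 / 4)) * ((29291 / 31250 : ℝ) - 8 * (-711 / 250) * (1 / 5))) /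
        (0 - (-1 / 4)) := by
  have hA := freeGCPressureTT'_b8_tpm1o4_n1o5_le
  have hB := freeGCPressureTT'_b8_tp0_n1o5_le
  push_cast at hA hB
  exact pressureTT'_le_schord_of_freeGCPressureTT' (βh := 8) (by norm_num) (n := 1 / 5) (by norm_num) (by norm_num)
    (sa := -1 / 4) (sb := 0) (by norm_num) hA hB hs₁ hs₂ hU₁

/-- **FREE-GAS DILUTE ANCHOR at `n₁ = 1/4` on `t′ ∈ [-1/4, 0]`** (`β_h = 8`, every `U ≥ 0`): `t′`-chord of the kernel ceilings `P₀(8, -1/4, -559/250) ≤ 205801/250000`,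
`P₀(8, 0, -2583/1000) ≤ 703461/500000` Legendre-shifted to density `1/4` (`5.2952040` @ `-1/4`, `6.5729220` @ `0`). [cite: Ruelle1969, §3.4] [cite: Israel1979, Thm. I.3.4] -/
theorem highU_freeDiluteCap_1o4_m1o4 {s₁ s₂ U₁ U₂ : ℝ} (hs₁ : -1 / 4 ≤ s₁) (hs₂ : s₂ ≤ 0) (hU₁ : 0 ≤ U₁) :
    ∀ s ∈ Icc s₁ s₂, ∀ U ∈ Icc U₁ U₂, pressureTT' (8 : ℝ) 1 s U (1 / 4 : ℝ) ≤
      ((0 - s) * ((205801 / 250000 : ℝ) - 8 * (-559 / 250) * (1 / 4)) + (s - (-1 / 4)) * ((703461 / 500000 : ℝ) - 8 * (-2583 / 1000) * (1 / 4))) /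
        (0 - (-1 / 4)) := by
  have hA := freeGCPressureTT'_b8_tpm1o4_n1o4_le
  have hB := freeGCPressureTT'_b8_tp0_n1o4_le
  push_cast at hA hB
  exact pressureTT'_le_schord_of_freeGCPressureTT' (βh := 8) (by norm_num) (n := 1 / 4) (by norm_num) (by norm_num)
    (sa := -1 / 4) (sb := 0) (by norm_num) hA hB hs₁ hs₂ hU₁

/-! ## §1 `(≤ 1/5 | ≥ 1)` at `T > 0` on the large-`U` strip cells -/

/-- **`(≤ 1/5 | ≥ 1)` EXCLUDED in thermal states on `t′ ∈ [−3/20, 0] × U ∈ [8, 12]`, every `β ≥ 17`** (cell A; columns `lsco_n1_law8_of` ∣ `tri_n1_law12h_of`; `n₂`-anchor `β_h = 1`; g24 `20`). (`β₀ = 16.45`; `T = 0` column margins `≥ 0.0375`). [cite: Israel1979, Thm. I.2.4] [cite: EmeryKivelsonLin1990, pp. 475–476] [cite: PoulinHastings2011, eqs. (3)–(8)] [cite: Griffiths1966, §II] [cite: Ruelle1969, §3.4] -/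
theorem highU_psTF_1o5_A_beta17 (hVB : cert_obx32x4tpm1o4D1200_openbox_32x4_N112_planes)
    (hK8 : cert_laBoxE_K2diag_GU8n1tpm3o10_j299783_up)
    (h472 : cert_r472_pb2_tl_upper_n1_U8) (h428 : cert_r428_hubSQ_hanK7R6_U8_r5_e4_so4blk)
    (h502 : cert_r502_hubSQ_hanK7R6_U16_r5_e4_so4blk) (hC1 : cert_feC1tt_stair221_tpm1o4_b1_j300793)
    {s : ℝ} (hs : s ∈ Icc (-3 / 20 : ℝ) 0) {U : ℝ} (hU : U ∈ Icc (8 : ℝ) (12))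
    {β : ℝ} (hβ : (17 : ℝ) ≤ β)
    {ω₁ ω₂ : InfVolFermionState 2} (h₁ : ω₁.IsTranslationInvariant) (h₂ : ω₂.IsTranslationInvariant)
    (hρ₁ : 0 < ω₁.density) (hρ₁' : ω₁.density ≤ 1 / 5) (hρ₂ : 1 ≤ ω₂.density) (hρ₂' : ω₂.density < 2)
    {n : ℝ} (hn0 : 0 < n) (hn2 : n < 2) {lam : ℝ} (hl0 : 0 < lam) (hl1 : lam < 1) {Ls : ℕ → ℕ}
    (hLs : Tendsto Ls atTop atTop) :
    ¬ (mix lam hl0.le hl1.le ω₁ ω₂).IsTorusLimitOfMixture (sectorGibbsCount n) (fun L => sectorGibbsWeightTT' β 1 s U n L)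
      (fun L => sectorGibbsVectorTT' 1 s U n L) Ls := by
  refine psT_not_thermal_mix_on_cell_of_columns_hotAnchorSS 1 (s₁ := -3 / 20) (s₂ := 0) (U₁ := 8) (U₂ := 12)
    (n₁ := 1 / 5) (n₂ := 1) (a := 5 / 32) (b := 27 / 32) (β₀ := 17) (βh₁ := 8) (βh₂ := 1)
    (by norm_num) (by norm_num) (by norm_num) (by norm_num) (by norm_num) (by norm_num) (by norm_num) (by norm_num)
    (by norm_num) (by norm_num) (by norm_num) (by norm_num) hβ (by norm_num)
    (lsco78_capPlane_on_cell_of hVB (by norm_num) (by norm_num) (by norm_num))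
    (fun s hs => lsco_n1_law8_of hK8 h472 h428 s ⟨hs.1.trans' (by norm_num), hs.2⟩)
    (fun s hs => tri_n1_law12h_of hK8 h472 h428 h502 s hs)
    (fun s hs U hU => strip_dilute1o5_floor (n₁ := 1 / 5) (by norm_num) (by norm_num) s ⟨hs.1.trans' (by norm_num), hs.2⟩ U (by linarith [hU.1]))
    (highU_freeDiluteCap_1o5_m3o20 (by norm_num) (by norm_num) (by norm_num))
    (lsco_hotCap_n1_b1_j300793_on_cell hC1 (by norm_num) (by norm_num) (by norm_num))
    ?_ ?_ ?_ ?_ hs hU h₁ h₂ hρ₁ hρ₁' hρ₂ hρ₂' hn0 hn2 hl0 hl1 hLs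
  · intro s hs; obtain ⟨h1, h2⟩ := hs; push_cast; norm_num; nlinarith [h1, h2]
  · intro s hs; obtain ⟨h1, h2⟩ := hs; push_cast; norm_num; nlinarith [h1, h2]
  · intro s hs; obtain ⟨h1, h2⟩ := hs; push_cast; norm_num; nlinarith [h1, h2]
  · intro s hs; obtain ⟨h1, h2⟩ := hs; push_cast; norm_num; nlinarith [h1, h2]

/-- **`(≤ 1/5 | ≥ 1)` on `t′ ∈ [−3/20, 0] × U ∈ [8, 10]`, every `β ≥ 11`** (cell A′; second column = `U`-chord law `hU_n1_law10_of_12h`; `β_h = 3/2`; g24 `13`). (`β₀ = 10.72`; `T = 0` column margins `≥ 0.0523`). [cite: Israel1979, Thm. I.2.4] [cite: EmeryKivelsonLin1990, pp. 475–476] [cite: PoulinHastings2011, eqs. (3)–(8)] [cite: Griffiths1966, §II] [cite: Ruelle1969, §3.4] -/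
theorem highU_psTF_1o5_A10_beta11 (hVB : cert_obx32x4tpm1o4D1200_openbox_32x4_N112_planes)
    (hK8 : cert_laBoxE_K2diag_GU8n1tpm3o10_j299783_up)
    (h472 : cert_r472_pb2_tl_upper_n1_U8) (h428 : cert_r428_hubSQ_hanK7R6_U8_r5_e4_so4blk)
    (h502 : cert_r502_hubSQ_hanK7R6_U16_r5_e4_so4blk) (hC1 : cert_feC1tt_stair221_tpm1o4_b3o2_j300793)
    {s : ℝ} (hs : s ∈ Icc (-3 / 20 : ℝ) 0) {U : ℝ} (hU : U ∈ Icc (8 : ℝ) (10))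
    {β : ℝ} (hβ : (11 : ℝ) ≤ β)
    {ω₁ ω₂ : InfVolFermionState 2} (h₁ : ω₁.IsTranslationInvariant) (h₂ : ω₂.IsTranslationInvariant)
    (hρ₁ : 0 < ω₁.density) (hρ₁' : ω₁.density ≤ 1 / 5) (hρ₂ : 1 ≤ ω₂.density) (hρ₂' : ω₂.density < 2)
    {n : ℝ} (hn0 : 0 < n) (hn2 : n < 2) {lam : ℝ} (hl0 : 0 < lam) (hl1 : lam < 1) {Ls : ℕ → ℕ}
    (hLs : Tendsto Ls atTop atTop) :
    ¬ (mix lam hl0.le hl1.le ω₁ ω₂).IsTorusLimitOfMixture (sectorGibbsCount n) (fun L => sectorGibbsWeightTT' β 1 s U n L)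
      (fun L => sectorGibbsVectorTT' 1 s U n L) Ls := by
  refine psT_not_thermal_mix_on_cell_of_columns_hotAnchorSS 1 (s₁ := -3 / 20) (s₂ := 0) (U₁ := 8) (U₂ := 10)
    (n₁ := 1 / 5) (n₂ := 1) (a := 5 / 32) (b := 27 / 32) (β₀ := 11) (βh₁ := 8) (βh₂ := 3 / 2)
    (by norm_num) (by norm_num) (by norm_num) (by norm_num) (by norm_num) (by norm_num) (by norm_num) (by norm_num)
    (by norm_num) (by norm_num) (by norm_num) (by norm_num) hβ (by norm_num)
    (lsco78_capPlane_on_cell_of hVB (by norm_num) (by norm_num) (by norm_num))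
    (fun s hs => lsco_n1_law8_of hK8 h472 h428 s ⟨hs.1.trans' (by norm_num), hs.2⟩)
    (hU_n1_law10_of_12h hK8 h472 h428 h502)
    (fun s hs U hU => strip_dilute1o5_floor (n₁ := 1 / 5) (by norm_num) (by norm_num) s ⟨hs.1.trans' (by norm_num), hs.2⟩ U (by linarith [hU.1]))
    (highU_freeDiluteCap_1o5_m3o20 (by norm_num) (by norm_num) (by norm_num))
    (lsco_hotCap_n1_b3o2_j300793_on_cell hC1 (by norm_num) (by norm_num) (by norm_num))
    ?_ ?_ ?_ ?_ hs hU h₁ h₂ hρ₁ hρ₁' hρ₂ hρ₂' hn0 hn2 hl0 hl1 hLs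
  · intro s hs; obtain ⟨h1, h2⟩ := hs; push_cast; norm_num; nlinarith [h1, h2]
  · intro s hs; obtain ⟨h1, h2⟩ := hs; push_cast; norm_num; nlinarith [h1, h2]
  · intro s hs; obtain ⟨h1, h2⟩ := hs; push_cast; norm_num; nlinarith [h1, h2]
  · intro s hs; obtain ⟨h1, h2⟩ := hs; push_cast; norm_num; nlinarith [h1, h2]

/-- **`(≤ 1/5 | ≥ 1)` on `t′ ∈ [−1/5, 0] × U ∈ [8, 10]`, every `β ≥ 12`** (cell B; columns `lsco_n1_law8_of` ∣ `tri_n1_law10m_of`; `β_h = 3/2`; g24 `14`). (`β₀ = 11.32`; `T = 0` column margins `≥ 0.0485`). [cite: Israel1979, Thm. I.2.4] [cite: EmeryKivelsonLin1990, pp. 475–476] [cite: PoulinHastings2011, eqs. (3)–(8)] [cite: Griffiths1966, §II] [cite: Ruelle1969, §3.4] -/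
theorem highU_psTF_1o5_B_beta12 (hVB : cert_obx32x4tpm1o4D1200_openbox_32x4_N112_planes)
    (hK8 : cert_laBoxE_K2diag_GU8n1tpm3o10_j299783_up)
    (h472 : cert_r472_pb2_tl_upper_n1_U8) (h428 : cert_r428_hubSQ_hanK7R6_U8_r5_e4_so4blk)
    (h489 : cert_r489_hubSQ_hanK7R6_U12_r5_e4_so4blk) (h502 : cert_r502_hubSQ_hanK7R6_U16_r5_e4_so4blk) (hC1 : cert_feC1tt_stair221_tpm1o4_b3o2_j300793)
    {s : ℝ} (hs : s ∈ Icc (-1 / 5 : ℝ) 0) {U : ℝ} (hU : U ∈ Icc (8 : ℝ) (10))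
    {β : ℝ} (hβ : (12 : ℝ) ≤ β)
    {ω₁ ω₂ : InfVolFermionState 2} (h₁ : ω₁.IsTranslationInvariant) (h₂ : ω₂.IsTranslationInvariant)
    (hρ₁ : 0 < ω₁.density) (hρ₁' : ω₁.density ≤ 1 / 5) (hρ₂ : 1 ≤ ω₂.density) (hρ₂' : ω₂.density < 2)
    {n : ℝ} (hn0 : 0 < n) (hn2 : n < 2) {lam : ℝ} (hl0 : 0 < lam) (hl1 : lam < 1) {Ls : ℕ → ℕ}
    (hLs : Tendsto Ls atTop atTop) :
    ¬ (mix lam hl0.le hl1.le ω₁ ω₂).IsTorusLimitOfMixture (sectorGibbsCount n) (fun L => sectorGibbsWeightTT' β 1 s U n L)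
      (fun L => sectorGibbsVectorTT' 1 s U n L) Ls := by
  refine psT_not_thermal_mix_on_cell_of_columns_hotAnchorSS 1 (s₁ := -1 / 5) (s₂ := 0) (U₁ := 8) (U₂ := 10)
    (n₁ := 1 / 5) (n₂ := 1) (a := 5 / 32) (b := 27 / 32) (β₀ := 12) (βh₁ := 8) (βh₂ := 3 / 2)
    (by norm_num) (by norm_num) (by norm_num) (by norm_num) (by norm_num) (by norm_num) (by norm_num) (by norm_num)
    (by norm_num) (by norm_num) (by norm_num) (by norm_num) hβ (by norm_num)
    (lsco78_capPlane_on_cell_of hVB (by norm_num) (by norm_num) (by norm_num))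
    (fun s hs => lsco_n1_law8_of hK8 h472 h428 s ⟨hs.1.trans' (by norm_num), hs.2⟩)
    (fun s hs => tri_n1_law10m_of hK8 h472 h428 h489 h502 s hs)
    (fun s hs U hU => strip_dilute1o5_floor (n₁ := 1 / 5) (by norm_num) (by norm_num) s ⟨hs.1.trans' (by norm_num), hs.2⟩ U (by linarith [hU.1]))
    (strip_freeDiluteCap_1o5 (by norm_num) (by norm_num) (by norm_num))
    (lsco_hotCap_n1_b3o2_j300793_on_cell hC1 (by norm_num) (by norm_num) (by norm_num))
    ?_ ?_ ?_ ?_ hs hU h₁ h₂ hρ₁ hρ₁' hρ₂ hρ₂' hn0 hn2 hl0 hl1 hLs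
  · intro s hs; obtain ⟨h1, h2⟩ := hs; push_cast; norm_num; nlinarith [h1, h2]
  · intro s hs; obtain ⟨h1, h2⟩ := hs; push_cast; norm_num; nlinarith [h1, h2]
  · intro s hs; obtain ⟨h1, h2⟩ := hs; push_cast; norm_num; nlinarith [h1, h2]
  · intro s hs; obtain ⟨h1, h2⟩ := hs; push_cast; norm_num; nlinarith [h1, h2]

/-- **`(≤ 1/5 | ≥ 1)` on `t′ ∈ [−1/4, 0] × U ∈ [8, 9]`, every `β ≥ 15`** (cell C′; second column = `hU_n1_law9_of_10f`; dilute floor `highU_dilute1o5_floor_q`; `β_h = 3/2`; g24 `18`). (`β₀ = 14.53`; `T = 0` column margins `≥ 0.0318`). [cite: Israel1979, Thm. I.2.4] [cite: EmeryKivelsonLin1990, pp. 475–476] [cite: PoulinHastings2011, eqs. (3)–(8)] [cite: Griffiths1966, §II] [cite: Ruelle1969, §3.4] -/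
theorem highU_psTF_1o5_C9_beta15 (hVB : cert_obx32x4tpm1o4D1200_openbox_32x4_N112_planes)
    (hK8 : cert_laBoxE_K2diag_GU8n1tpm3o10_j299783_up)
    (h472 : cert_r472_pb2_tl_upper_n1_U8) (h428 : cert_r428_hubSQ_hanK7R6_U8_r5_e4_so4blk)
    (h502 : cert_r502_hubSQ_hanK7R6_U16_r5_e4_so4blk) (hC1 : cert_feC1tt_stair221_tpm1o4_b3o2_j300793)
    {s : ℝ} (hs : s ∈ Icc (-1 / 4 : ℝ) 0) {U : ℝ} (hU : U ∈ Icc (8 : ℝ) (9))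
    {β : ℝ} (hβ : (15 : ℝ) ≤ β)
    {ω₁ ω₂ : InfVolFermionState 2} (h₁ : ω₁.IsTranslationInvariant) (h₂ : ω₂.IsTranslationInvariant)
    (hρ₁ : 0 < ω₁.density) (hρ₁' : ω₁.density ≤ 1 / 5) (hρ₂ : 1 ≤ ω₂.density) (hρ₂' : ω₂.density < 2)
    {n : ℝ} (hn0 : 0 < n) (hn2 : n < 2) {lam : ℝ} (hl0 : 0 < lam) (hl1 : lam < 1) {Ls : ℕ → ℕ}
    (hLs : Tendsto Ls atTop atTop) :
    ¬ (mix lam hl0.le hl1.le ω₁ ω₂).IsTorusLimitOfMixture (sectorGibbsCount n) (fun L => sectorGibbsWeightTT' β 1 s U n L)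
      (fun L => sectorGibbsVectorTT' 1 s U n L) Ls := by
  refine psT_not_thermal_mix_on_cell_of_columns_hotAnchorSS 1 (s₁ := -1 / 4) (s₂ := 0) (U₁ := 8) (U₂ := 9)
    (n₁ := 1 / 5) (n₂ := 1) (a := 5 / 32) (b := 27 / 32) (β₀ := 15) (βh₁ := 8) (βh₂ := 3 / 2)
    (by norm_num) (by norm_num) (by norm_num) (by norm_num) (by norm_num) (by norm_num) (by norm_num) (by norm_num)
    (by norm_num) (by norm_num) (by norm_num) (by norm_num) hβ (by norm_num)
    (lsco78_capPlane_on_cell_of hVB (by norm_num) (by norm_num) (by norm_num))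
    (fun s hs => lsco_n1_law8_of hK8 h472 h428 s ⟨hs.1.trans' (by norm_num), hs.2⟩)
    (hU_n1_law9_of_10f hK8 h472 h428 h502)
    (fun s hs U hU => highU_dilute1o5_floor_q (n₁ := 1 / 5) (by norm_num) (by norm_num) s ⟨hs.1.trans' (by norm_num), hs.2⟩ U (by linarith [hU.1]))
    (highU_freeDiluteCap_1o5_m1o4 (by norm_num) (by norm_num) (by norm_num))
    (lsco_hotCap_n1_b3o2_j300793_on_cell hC1 (by norm_num) (by norm_num) (by norm_num))
    ?_ ?_ ?_ ?_ hs hU h₁ h₂ hρ₁ hρ₁' hρ₂ hρ₂' hn0 hn2 hl0 hl1 hLs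
  · intro s hs; obtain ⟨h1, h2⟩ := hs; push_cast; norm_num; nlinarith [h1, h2]
  · intro s hs; obtain ⟨h1, h2⟩ := hs; push_cast; norm_num; nlinarith [h1, h2]
  · intro s hs; obtain ⟨h1, h2⟩ := hs; push_cast; norm_num; nlinarith [h1, h2]
  · intro s hs; obtain ⟨h1, h2⟩ := hs; push_cast; norm_num; nlinarith [h1, h2]

/-! ## §2 `(≤ 1/4 | ≥ 1)` and `(≤ 3/10 | ≥ 1)` at `T > 0` -/

/-- **`(≤ 1/4 | ≥ 1)` on `t′ ∈ [−3/20, 0] × U ∈ [8, 10]`, every `β ≥ 18`** (cell A′; `β_h = 3/2`; g24 `22`). (`β₀ = 17.82`; `T = 0` column margins `≥ 0.0311`). [cite: Israel1979, Thm. I.2.4] [cite: EmeryKivelsonLin1990, pp. 475–476] [cite: PoulinHastings2011, eqs. (3)–(8)] [cite: Griffiths1966, §II] [cite: Ruelle1969, §3.4] -/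
theorem highU_psTF_1o4_A10_beta18 (hVB : cert_obx32x4tpm1o4D1200_openbox_32x4_N112_planes)
    (hK8 : cert_laBoxE_K2diag_GU8n1tpm3o10_j299783_up)
    (h472 : cert_r472_pb2_tl_upper_n1_U8) (h428 : cert_r428_hubSQ_hanK7R6_U8_r5_e4_so4blk)
    (h502 : cert_r502_hubSQ_hanK7R6_U16_r5_e4_so4blk) (hC1 : cert_feC1tt_stair221_tpm1o4_b3o2_j300793)
    {s : ℝ} (hs : s ∈ Icc (-3 / 20 : ℝ) 0) {U : ℝ} (hU : U ∈ Icc (8 : ℝ) (10))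
    {β : ℝ} (hβ : (18 : ℝ) ≤ β)
    {ω₁ ω₂ : InfVolFermionState 2} (h₁ : ω₁.IsTranslationInvariant) (h₂ : ω₂.IsTranslationInvariant)
    (hρ₁ : 0 < ω₁.density) (hρ₁' : ω₁.density ≤ 1 / 4) (hρ₂ : 1 ≤ ω₂.density) (hρ₂' : ω₂.density < 2)
    {n : ℝ} (hn0 : 0 < n) (hn2 : n < 2) {lam : ℝ} (hl0 : 0 < lam) (hl1 : lam < 1) {Ls : ℕ → ℕ}
    (hLs : Tendsto Ls atTop atTop) :
    ¬ (mix lam hl0.le hl1.le ω₁ ω₂).IsTorusLimitOfMixture (sectorGibbsCount n) (fun L => sectorGibbsWeightTT' β 1 s U n L)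
      (fun L => sectorGibbsVectorTT' 1 s U n L) Ls := by
  refine psT_not_thermal_mix_on_cell_of_columns_hotAnchorSS 1 (s₁ := -3 / 20) (s₂ := 0) (U₁ := 8) (U₂ := 10)
    (n₁ := 1 / 4) (n₂ := 1) (a := 1 / 6) (b := 5 / 6) (β₀ := 18) (βh₁ := 8) (βh₂ := 3 / 2)
    (by norm_num) (by norm_num) (by norm_num) (by norm_num) (by norm_num) (by norm_num) (by norm_num) (by norm_num)
    (by norm_num) (by norm_num) (by norm_num) (by norm_num) hβ (by norm_num)
    (lsco78_capPlane_on_cell_of hVB (by norm_num) (by norm_num) (by norm_num))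
    (fun s hs => lsco_n1_law8_of hK8 h472 h428 s ⟨hs.1.trans' (by norm_num), hs.2⟩)
    (hU_n1_law10_of_12h hK8 h472 h428 h502)
    (fun s hs U hU => strip_dilute1o4_floor (n₁ := 1 / 4) (by norm_num) (by norm_num) s ⟨hs.1.trans' (by norm_num), hs.2⟩ U (by linarith [hU.1]))
    (highU_freeDiluteCap_1o4_m3o20 (by norm_num) (by norm_num) (by norm_num))
    (lsco_hotCap_n1_b3o2_j300793_on_cell hC1 (by norm_num) (by norm_num) (by norm_num))
    ?_ ?_ ?_ ?_ hs hU h₁ h₂ hρ₁ hρ₁' hρ₂ hρ₂' hn0 hn2 hl0 hl1 hLs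
  · intro s hs; obtain ⟨h1, h2⟩ := hs; push_cast; norm_num; nlinarith [h1, h2]
  · intro s hs; obtain ⟨h1, h2⟩ := hs; push_cast; norm_num; nlinarith [h1, h2]
  · intro s hs; obtain ⟨h1, h2⟩ := hs; push_cast; norm_num; nlinarith [h1, h2]
  · intro s hs; obtain ⟨h1, h2⟩ := hs; push_cast; norm_num; nlinarith [h1, h2]

/-- **`(≤ 1/4 | ≥ 1)` on `t′ ∈ [−1/5, 0] × U ∈ [8, 10]`, every `β ≥ 20`** (cell B; `β_h = 3/2`; g24 `24`). (`β₀ = 19.13`; `T = 0` column margins `≥ 0.0284`). [cite: Israel1979, Thm. I.2.4] [cite: EmeryKivelsonLin1990, pp. 475–476] [cite: PoulinHastings2011, eqs. (3)–(8)] [cite: Griffiths1966, §II] [cite: Ruelle1969, §3.4] -/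
theorem highU_psTF_1o4_B_beta20 (hVB : cert_obx32x4tpm1o4D1200_openbox_32x4_N112_planes)
    (hK8 : cert_laBoxE_K2diag_GU8n1tpm3o10_j299783_up)
    (h472 : cert_r472_pb2_tl_upper_n1_U8) (h428 : cert_r428_hubSQ_hanK7R6_U8_r5_e4_so4blk)
    (h489 : cert_r489_hubSQ_hanK7R6_U12_r5_e4_so4blk) (h502 : cert_r502_hubSQ_hanK7R6_U16_r5_e4_so4blk) (hC1 : cert_feC1tt_stair221_tpm1o4_b3o2_j300793)
    {s : ℝ} (hs : s ∈ Icc (-1 / 5 : ℝ) 0) {U : ℝ} (hU : U ∈ Icc (8 : ℝ) (10))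
    {β : ℝ} (hβ : (20 : ℝ) ≤ β)
    {ω₁ ω₂ : InfVolFermionState 2} (h₁ : ω₁.IsTranslationInvariant) (h₂ : ω₂.IsTranslationInvariant)
    (hρ₁ : 0 < ω₁.density) (hρ₁' : ω₁.density ≤ 1 / 4) (hρ₂ : 1 ≤ ω₂.density) (hρ₂' : ω₂.density < 2)
    {n : ℝ} (hn0 : 0 < n) (hn2 : n < 2) {lam : ℝ} (hl0 : 0 < lam) (hl1 : lam < 1) {Ls : ℕ → ℕ}
    (hLs : Tendsto Ls atTop atTop) :
    ¬ (mix lam hl0.le hl1.le ω₁ ω₂).IsTorusLimitOfMixture (sectorGibbsCount n) (fun L => sectorGibbsWeightTT' β 1 s U n L)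
      (fun L => sectorGibbsVectorTT' 1 s U n L) Ls := by
  refine psT_not_thermal_mix_on_cell_of_columns_hotAnchorSS 1 (s₁ := -1 / 5) (s₂ := 0) (U₁ := 8) (U₂ := 10)
    (n₁ := 1 / 4) (n₂ := 1) (a := 1 / 6) (b := 5 / 6) (β₀ := 20) (βh₁ := 8) (βh₂ := 3 / 2)
    (by norm_num) (by norm_num) (by norm_num) (by norm_num) (by norm_num) (by norm_num) (by norm_num) (by norm_num)
    (by norm_num) (by norm_num) (by norm_num) (by norm_num) hβ (by norm_num)
    (lsco78_capPlane_on_cell_of hVB (by norm_num) (by norm_num) (by norm_num))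
    (fun s hs => lsco_n1_law8_of hK8 h472 h428 s ⟨hs.1.trans' (by norm_num), hs.2⟩)
    (fun s hs => tri_n1_law10m_of hK8 h472 h428 h489 h502 s hs)
    (fun s hs U hU => strip_dilute1o4_floor (n₁ := 1 / 4) (by norm_num) (by norm_num) s ⟨hs.1.trans' (by norm_num), hs.2⟩ U (by linarith [hU.1]))
    (strip_freeDiluteCap_1o4 (by norm_num) (by norm_num) (by norm_num))
    (lsco_hotCap_n1_b3o2_j300793_on_cell hC1 (by norm_num) (by norm_num) (by norm_num))
    ?_ ?_ ?_ ?_ hs hU h₁ h₂ hρ₁ hρ₁' hρ₂ hρ₂' hn0 hn2 hl0 hl1 hLs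
  · intro s hs; obtain ⟨h1, h2⟩ := hs; push_cast; norm_num; nlinarith [h1, h2]
  · intro s hs; obtain ⟨h1, h2⟩ := hs; push_cast; norm_num; nlinarith [h1, h2]
  · intro s hs; obtain ⟨h1, h2⟩ := hs; push_cast; norm_num; nlinarith [h1, h2]
  · intro s hs; obtain ⟨h1, h2⟩ := hs; push_cast; norm_num; nlinarith [h1, h2]

/-- **`(≤ 1/4 | ≥ 1)` on `t′ ∈ [−1/4, 0] × U ∈ [8, 9]`, every `β ≥ 19`** (cell C′ of box-p3's `…HighUD`: columns `lsco_n1_law8_of` ∣ `tri_n1_law9f_of`; dilute floor `highU_dilute1o4_floor_q`; `β_h = 3/2`; not typed at `T > 0` before). (`β₀ = 18.76`; `T = 0` column margins `≥ 0.0256`). [cite: Israel1979, Thm. I.2.4] [cite: EmeryKivelsonLin1990, pp. 475–476] [cite: PoulinHastings2011, eqs. (3)–(8)] [cite: Griffiths1966, §II] [cite: Ruelle1969, §3.4] -/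
theorem highU_psTF_1o4_C9_beta19 (hVB : cert_obx32x4tpm1o4D1200_openbox_32x4_N112_planes)
    (hK8 : cert_laBoxE_K2diag_GU8n1tpm3o10_j299783_up)
    (h472 : cert_r472_pb2_tl_upper_n1_U8) (h428 : cert_r428_hubSQ_hanK7R6_U8_r5_e4_so4blk)
    (h489 : cert_r489_hubSQ_hanK7R6_U12_r5_e4_so4blk) (h502 : cert_r502_hubSQ_hanK7R6_U16_r5_e4_so4blk) (hC1 : cert_feC1tt_stair221_tpm1o4_b3o2_j300793)
    {s : ℝ} (hs : s ∈ Icc (-1 / 4 : ℝ) 0) {U : ℝ} (hU : U ∈ Icc (8 : ℝ) (9))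
    {β : ℝ} (hβ : (19 : ℝ) ≤ β)
    {ω₁ ω₂ : InfVolFermionState 2} (h₁ : ω₁.IsTranslationInvariant) (h₂ : ω₂.IsTranslationInvariant)
    (hρ₁ : 0 < ω₁.density) (hρ₁' : ω₁.density ≤ 1 / 4) (hρ₂ : 1 ≤ ω₂.density) (hρ₂' : ω₂.density < 2)
    {n : ℝ} (hn0 : 0 < n) (hn2 : n < 2) {lam : ℝ} (hl0 : 0 < lam) (hl1 : lam < 1) {Ls : ℕ → ℕ}
    (hLs : Tendsto Ls atTop atTop) :
    ¬ (mix lam hl0.le hl1.le ω₁ ω₂).IsTorusLimitOfMixture (sectorGibbsCount n) (fun L => sectorGibbsWeightTT' β 1 s U n L)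
      (fun L => sectorGibbsVectorTT' 1 s U n L) Ls := by
  refine psT_not_thermal_mix_on_cell_of_columns_hotAnchorSS 1 (s₁ := -1 / 4) (s₂ := 0) (U₁ := 8) (U₂ := 9)
    (n₁ := 1 / 4) (n₂ := 1) (a := 1 / 6) (b := 5 / 6) (β₀ := 19) (βh₁ := 8) (βh₂ := 3 / 2)
    (by norm_num) (by norm_num) (by norm_num) (by norm_num) (by norm_num) (by norm_num) (by norm_num) (by norm_num)
    (by norm_num) (by norm_num) (by norm_num) (by norm_num) hβ (by norm_num)
    (lsco78_capPlane_on_cell_of hVB (by norm_num) (by norm_num) (by norm_num))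
    (fun s hs => lsco_n1_law8_of hK8 h472 h428 s ⟨hs.1.trans' (by norm_num), hs.2⟩)
    (fun s hs => tri_n1_law9f_of hK8 h472 h428 h489 h502 s hs)
    (fun s hs U hU => highU_dilute1o4_floor_q (n₁ := 1 / 4) (by norm_num) (by norm_num) s ⟨hs.1.trans' (by norm_num), hs.2⟩ U (by linarith [hU.1]))
    (highU_freeDiluteCap_1o4_m1o4 (by norm_num) (by norm_num) (by norm_num))
    (lsco_hotCap_n1_b3o2_j300793_on_cell hC1 (by norm_num) (by norm_num) (by norm_num))
    ?_ ?_ ?_ ?_ hs hU h₁ h₂ hρ₁ hρ₁' hρ₂ hρ₂' hn0 hn2 hl0 hl1 hLs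
  · intro s hs; obtain ⟨h1, h2⟩ := hs; push_cast; norm_num; nlinarith [h1, h2]
  · intro s hs; obtain ⟨h1, h2⟩ := hs; push_cast; norm_num; nlinarith [h1, h2]
  · intro s hs; obtain ⟨h1, h2⟩ := hs; push_cast; norm_num; nlinarith [h1, h2]
  · intro s hs; obtain ⟨h1, h2⟩ := hs; push_cast; norm_num; nlinarith [h1, h2]

/-- **`(≤ 3/10 | ≥ 1)` on `t′ ∈ [−1/10, 0] × U ∈ [8, 9]`, every `β ≥ 21`** (cell A′; second column = `hU_n1_law9_of_12t`; dilute anchor chorded over `[−3/20, 0] ⊇ [−1/10, 0]`; `β_h = 3/2`; g24 `27`). (`β₀ = 20.36`; `T = 0` column margins `≥ 0.0260`). [cite: Israel1979, Thm. I.2.4] [cite: EmeryKivelsonLin1990, pp. 475–476] [cite: PoulinHastings2011, eqs. (3)–(8)] [cite: Griffiths1966, §II] [cite: Ruelle1969, §3.4] -/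
theorem highU_psTF_3o10_A9_beta21 (hVB : cert_obx32x4tpm1o4D1200_openbox_32x4_N112_planes)
    (hK8 : cert_laBoxE_K2diag_GU8n1tpm3o10_j299783_up)
    (h472 : cert_r472_pb2_tl_upper_n1_U8) (h428 : cert_r428_hubSQ_hanK7R6_U8_r5_e4_so4blk)
    (h489 : cert_r489_hubSQ_hanK7R6_U12_r5_e4_so4blk) (h502 : cert_r502_hubSQ_hanK7R6_U16_r5_e4_so4blk) (hC1 : cert_feC1tt_stair221_tpm1o4_b3o2_j300793)
    {s : ℝ} (hs : s ∈ Icc (-1 / 10 : ℝ) 0) {U : ℝ} (hU : U ∈ Icc (8 : ℝ) (9))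
    {β : ℝ} (hβ : (21 : ℝ) ≤ β)
    {ω₁ ω₂ : InfVolFermionState 2} (h₁ : ω₁.IsTranslationInvariant) (h₂ : ω₂.IsTranslationInvariant)
    (hρ₁ : 0 < ω₁.density) (hρ₁' : ω₁.density ≤ 3 / 10) (hρ₂ : 1 ≤ ω₂.density) (hρ₂' : ω₂.density < 2)
    {n : ℝ} (hn0 : 0 < n) (hn2 : n < 2) {lam : ℝ} (hl0 : 0 < lam) (hl1 : lam < 1) {Ls : ℕ → ℕ}
    (hLs : Tendsto Ls atTop atTop) :
    ¬ (mix lam hl0.le hl1.le ω₁ ω₂).IsTorusLimitOfMixture (sectorGibbsCount n) (fun L => sectorGibbsWeightTT' β 1 s U n L)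
      (fun L => sectorGibbsVectorTT' 1 s U n L) Ls := by
  refine psT_not_thermal_mix_on_cell_of_columns_hotAnchorSS 1 (s₁ := -1 / 10) (s₂ := 0) (U₁ := 8) (U₂ := 9)
    (n₁ := 3 / 10) (n₂ := 1) (a := 5 / 28) (b := 23 / 28) (β₀ := 21) (βh₁ := 8) (βh₂ := 3 / 2)
    (by norm_num) (by norm_num) (by norm_num) (by norm_num) (by norm_num) (by norm_num) (by norm_num) (by norm_num)
    (by norm_num) (by norm_num) (by norm_num) (by norm_num) hβ (by norm_num)
    (lsco78_capPlane_on_cell_of hVB (by norm_num) (by norm_num) (by norm_num))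
    (fun s hs => lsco_n1_law8_of hK8 h472 h428 s ⟨hs.1.trans' (by norm_num), hs.2⟩)
    (hU_n1_law9_of_12t hK8 h472 h428 h489 h502)
    (fun s hs U hU => strip_dilute3o10_floor (n₁ := 3 / 10) (by norm_num) (by norm_num) s ⟨hs.1.trans' (by norm_num), hs.2⟩ U (by linarith [hU.1]))
    (highU_freeDiluteCap_3o10_m3o20 (by norm_num) (by norm_num) (by norm_num))
    (lsco_hotCap_n1_b3o2_j300793_on_cell hC1 (by norm_num) (by norm_num) (by norm_num))
    ?_ ?_ ?_ ?_ hs hU h₁ h₂ hρ₁ hρ₁' hρ₂ hρ₂' hn0 hn2 hl0 hl1 hLs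
  · intro s hs; obtain ⟨h1, h2⟩ := hs; push_cast; norm_num; nlinarith [h1, h2]
  · intro s hs; obtain ⟨h1, h2⟩ := hs; push_cast; norm_num; nlinarith [h1, h2]
  · intro s hs; obtain ⟨h1, h2⟩ := hs; push_cast; norm_num; nlinarith [h1, h2]
  · intro s hs; obtain ⟨h1, h2⟩ := hs; push_cast; norm_num; nlinarith [h1, h2]

end Summit.Ventures.CertifiedManyBodySolver.Observables
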